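import Mathlib
import Literature.NumberTheory.LFunctions.SiegelWalfisz
import Literature.NumberTheory.Sieve.BombieriVinogradovReduction
import Literature.NumberTheory.Sieve.BarbanDavenportHalberstamTools
import HarnessLib

/-!
# Route LiouvilleSarnak — support `AlignedTypeI` (stmt-ValiantsHypothesis-21040), line `characters_mod_2n`:
# small conductors — twisted von Mangoldt sums from the tree's PROVED Siegel–Walfisz theorem

Glue (G4b) towards the hypothesis of `alignedTypeI_of_primitiveLogWeightedPrimeCharSums` (`…BilinearSievePrimitive.lean`): the
Banks–Shparlinski input only covers conductors `2^j` with `j ≥ γ₀`; the finitely many small conductors are covered, uniformly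
in the required range, by Siegel–Walfisz, which is PROVED in the tree (`Literature.NumberTheory.LFunctions.siegel_walfisz_holds`).
Def-free:
* `norm_sum_vonMangoldt_char_le_of_siegelWalfisz` — for every `A > 0` there is `C` with
  `‖Σ_{n ≤ x} Λ(n) χ(n)‖ ≤ C · q · x / (log x)^A` for all `x ≥ 2`, `1 ≤ q ≤ (log x)^A` and non-principal `χ (mod q)`
  (`ψ(x,χ) = Σ_a χ(a) (ψ(x;q,a) − x/φ(q))` since `Σ_a χ(a) = 0`).

HONEST FRAMING. Bookkeeping over the tree's Siegel–Walfisz; `AlignedTypeI` is NOT closed here; nothing bears on `VP ≠ VNP`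
(NOT proved).
-/

set_option linter.dupNamespace false

noncomputable section

namespace Summit.ValiantsHypothesis.ValiantsHypothesis.Theorems.LiouvilleSarnak.AlignedTypeI.CharactersModTwoN

open Finset ArithmeticFunction
open Literature.NumberTheory.Sieve
open scoped BigOperators

/-- **Twisted von Mangoldt sums for non-principal characters of small modulus (Siegel–Walfisz range).**  For every `A > 0`
there is `C` such that for all real `x ≥ 2`, all `1 ≤ q ≤ (log x)^A` and all `χ ≠ 1 (mod q)`:
`‖Σ_{0 < n ≤ x} Λ(n) χ(n)‖ ≤ C · q · x / (log x)^A`. [folklore] -/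
theorem norm_sum_vonMangoldt_char_le_of_siegelWalfisz {A : ℝ} (hA : 0 < A) :
    ∃ C : ℝ, ∀ x : ℝ, 2 ≤ x → ∀ q : ℕ, 1 ≤ q → (q : ℝ) ≤ Real.log x ^ A →
      ∀ χ : DirichletCharacter ℂ q, χ ≠ 1 →
        ‖∑ n ∈ Finset.Ioc 0 ⌊x⌋₊, ((vonMangoldt n : ℝ) : ℂ) * χ (n : ZMod q)‖ ≤ C * q * x / Real.log x ^ A := by
  obtain ⟨C, hC⟩ := Literature.NumberTheory.LFunctions.siegel_walfisz_holds A hA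
  refine ⟨C, fun x hx q hq hqx χ hχ => ?_⟩
  haveI : NeZero q := ⟨by omega⟩
  have hC0 : 0 ≤ C * x / Real.log x ^ A := by
    -- the Siegel–Walfisz bound at the unit class is an absolute value, hence nonnegative
    have h := hC x hx q hq hqx 1
    exact le_trans (abs_nonneg _) h
  -- `ψ(x, χ) = Σ_a χ(a) ψ(x; q, a)` and `Σ_a χ(a) = 0`
  rw [← Literature.NumberTheory.Sieve.BDH.chebyshevPsiChar_eq_sum_Ioc,
    Literature.NumberTheory.Sieve.chebyshevPsiChar_eq_sum_units]
  have hzero : ∑ a : (ZMod q)ˣ, χ (a : ZMod q) * ((x / (Nat.totient q : ℝ) : ℝ) : ℂ) = 0 := by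
    rw [← Finset.sum_mul, Literature.NumberTheory.Sieve.sum_units_eq_zero_of_ne_one hχ, zero_mul]
  have hrw : ∑ a : (ZMod q)ˣ, χ (a : ZMod q) * (ParityWave0.chebyshevPsiMod q a x : ℂ) =
      ∑ a : (ZMod q)ˣ, χ (a : ZMod q) *
        (((ParityWave0.chebyshevPsiMod q a x - x / (Nat.totient q : ℝ) : ℝ)) : ℂ) := by
    rw [← sub_zero (∑ a : (ZMod q)ˣ, χ (a : ZMod q) * (ParityWave0.chebyshevPsiMod q a x : ℂ)), ← hzero,
      ← Finset.sum_sub_distrib]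
    refine Finset.sum_congr rfl fun a _ => ?_
    push_cast
    ring
  rw [hrw]
  calc ‖∑ a : (ZMod q)ˣ, χ (a : ZMod q) * (((ParityWave0.chebyshevPsiMod q a x - x / (Nat.totient q : ℝ) : ℝ)) : ℂ)‖
      ≤ ∑ a : (ZMod q)ˣ, ‖χ (a : ZMod q) * (((ParityWave0.chebyshevPsiMod q a x - x / (Nat.totient q : ℝ) : ℝ)) : ℂ)‖ :=
        norm_sum_le _ _
    _ ≤ ∑ _a : (ZMod q)ˣ, C * x / Real.log x ^ A := by
        refine Finset.sum_le_sum fun a _ => ?_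
        rw [norm_mul, Complex.norm_real, Real.norm_eq_abs]
        calc ‖χ (a : ZMod q)‖ * |ParityWave0.chebyshevPsiMod q a x - x / (Nat.totient q : ℝ)|
            ≤ 1 * (C * x / Real.log x ^ A) :=
              mul_le_mul (χ.norm_le_one _) (hC x hx q hq hqx a) (abs_nonneg _) zero_le_one
          _ = C * x / Real.log x ^ A := one_mul _
    _ = (Nat.totient q : ℝ) * (C * x / Real.log x ^ A) := by
        rw [Finset.sum_const, Finset.card_univ, ZMod.card_units_eq_totient, nsmul_eq_mul]
    _ ≤ (q : ℝ) * (C * x / Real.log x ^ A) :=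
        mul_le_mul_of_nonneg_right (by exact_mod_cast Nat.totient_le q) hC0
    _ = C * q * x / Real.log x ^ A := by ring

end Summit.ValiantsHypothesis.ValiantsHypothesis.Theorems.LiouvilleSarnak.AlignedTypeI.CharactersModTwoN
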